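import Summits.NavierStokesRegularity.NavierStokesRegularity.Theses.FrozenSignCascade
import Summits.NavierStokesRegularity.NavierStokesRegularity.Theorems.FrozenSignCascadeEnvelopeBoundStubMildUnique
import Summits.NavierStokesRegularity.NavierStokesRegularity.Theorems.FrozenSignCascadeEnvelopeBoundStubEnergyOfUnique
import Summits.NavierStokesRegularity.NavierStokesRegularity.Theorems.FrozenSignCascadeEnvelopeBoundReduction
import Summits.NavierStokesRegularity.NavierStokesRegularity.Theorems.FrozenSignCascadeEnvelopeBoundEnstrophy
import Summits.NavierStokesRegularity.NavierStokesRegularity.Theorems.FrozenSignCascadeEnvelopeBoundTimeDeriv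
import Summits.NavierStokesRegularity.NavierStokesRegularity.Theorems.FrozenSignCascadeEnvelopeBoundWeightedDeriv
import Summits.NavierStokesRegularity.NavierStokesRegularity.Theorems.FrozenSignCascadeEnvelopeBoundStubAgmonL1
import Summits.NavierStokesRegularity.NavierStokesRegularity.Theorems.FrozenSignCascadeEnvelopeBoundStubProductionL2
import Summits.NavierStokesRegularity.NavierStokesRegularity.Theorems.FrozenSignCascadeEnvelopeBoundStubEnergyCancellation
import HarnessLib.Audit

/-!
# Line `registered` of the crux `FrozenSignCascade.EnvelopeBound` — reshape r3 (lead c3):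
  the crux through Leray's energy/enstrophy mechanism

(crux item `stmt-NavierStokesRegularity-1549`, route `route-NavierStokesRegularity-FrozenSignCascade`;
tree path `Cruxes/EnvelopeBound/Lines/birth.lean`; registrar `planner-skel-stmt-NavierStokesRegularity-1549-0`,
reshapes r1/r2 by leads `…-1549-0` / `…-1549-c1-0`, re-registered unchanged by lead c2, reshape r3 by lead
`prover-line-stmt-NavierStokesRegularity-1549-c3-0`, 2026-08-17.)

THE CRUX. `EnvelopeBound` (A): for every `ν > 0`, every Clay datum `u₀` and every horizon `T₀ > 0` there is
`C = C(ν,u₀,T₀)` such that EVERY Fourier-side mild solution `V` on `[0,T]`, `T ≤ T₀`, issued from the Fourier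
datum (`IsFourierMild (4π²ν) 4 0 T V`, `V 0 = fourierData hu hd`) obeys `‖ξ‖² ‖V t ξ‖ ≤ C` on `[0,T] × ℝ³`.

WHY A RESHAPE. Reshape r2 had one open stub, `stub_highFrequencyBranch`, PROVABLY EQUIVALENT to the crux
(`Registered.envelopeBound_iff_highFrequencyBranch`, p148449), and every estimate the line had used was a
magnitude bound on the Duhamel formula (cheap-NS-blind; dead record `Lines/registered-dead.md`). The one
classical structure of the true equation that the line never used, and which is NOT magnitude-only, is the
ENERGY IDENTITY (it needs `divFree` + `conjSymm`; false for the cheap equation) and Leray's enstrophy mechanism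
built on it. Reshape r3 cuts the crux along that mechanism:

* `stub_energyDissip` [M, known-type, NEW]: the Fourier-side energy identity WITH DISSIPATION,
  `E(t) + 2c ∫ₛᵗ Ens = E(s)` along every Fourier-mild solution (`E = ∫∑ₗ‖Vₗ‖²`, `Ens = ∫‖ξ‖²∑ₗ‖Vₗ‖²`):
  time derivative of the energy under the integral sign (landed calculus layer
  `Theorems/…EnvelopeBoundTimeDeriv`, lead c3) and the cancellation `Re ∫∑ₗ conj(Vₗ) N(V,V)ₗ = 0`
  (frequency Leibniz rule + `divFree` kill the projector and the `η`-half, commutativity of `⋆`, one Fubini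
  and `conjSymm` show the remaining trilinear form is real, whence `Re(-2πi · real) = 0`).
* `stub_enstrophyBalance` [L, known-type, NEW]: the enstrophy balance `Ens' = -2c·D + P` at interior times
  with Leray's production bound `|P| ≤ K · Ens^{3/4} · D^{3/4}` (`D = ∫‖ξ‖⁴∑ₗ‖Vₗ‖²`; `K` absolute): time
  derivative of the enstrophy (calculus layer), the tree's `L²` bound of the nonlinearity under a bound of the
  synthesis (`eLpNorm_nonlin_le`, with `M = ‖V‖_{L¹_ξ}`), the Fourier-side Agmon inequality
  `‖V‖_{L¹_ξ} ≤ 2√(4π) Ens^{1/4} D^{1/4}` and Cauchy–Schwarz in `ξ`.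
* `stub_farFromLeray` [XL, OPEN — the heart]: for every `ν, u₀` and every enstrophy threshold `ω > 0`
  there is `C(ν,u₀,ω)` bounding the critical envelope `‖ξ‖²‖V t ξ‖` at every time `t` of every Fourier-mild
  solution from the datum UP TO WHICH the Fourier enstrophy has never dropped below `ω` ("far from Leray's
  absorbing small-data regime"). By the energy identity such times satisfy `t ≤ E₀/(2cω)`; so this is the
  crux on the a-priori bounded horizon `[0, E₀/(2cω)]`, stated intrinsically, and it is EQUIVALENT to the
  crux given the classical stubs (⇐ below; ⇒ energy identity). It is the whole open content: "no overshoot of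
  the critical envelope while the flow is outside Leray's absorbing ball `E·Ens ≤ θ c⁴`".

COMPOSITION (`EnvelopeBound_of`, real proof): Leray's lemma `leray_threshold` (there is an absolute `θ > 0`
such that `E(s)·Ens(s) ≤ θ c⁴` forces `Ens` to be non-increasing after `s`) is DERIVED here from
`stub_enstrophyBalance`, the energy inequality (`Registered.energyIneq`, p148449), the continuity of `Ens`
(`Leray.continuous_enstrophy`, landed) and Cauchy–Schwarz `Ens² ≤ E·D`, by a continuity (bootstrap) argument.
Then, for a mild `V` from the datum and a time `t`: either `Ens ≥ ω := θc⁴/(E₀+1)` on all of `[0,t]`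
(`stub_farFromLeray` bounds the envelope), or the first time `r₀ ≤ t` at which `Ens ≤ ω` (an infimum; `Ens` is
continuous) has its envelope bounded by the far stub (or is `0`, the datum), and from `r₀` on Leray's lemma
keeps `Ens ≤ ω`, so the landed `Registered.envelope_le_of_enstrophy` (p155124: energy × enstrophy controls the
critical envelope) bounds the envelope at `t`. The two landed classical stubs of r2 (`stub_mildUnique`
p146654, `stub_energyOfUnique` p146706) stay as references (uniqueness feeds `energyIneq`).

`EnvelopeBound_of : Theses.FrozenSignCascade.EnvelopeBound` is the ONLY theorem of this file concluding the
crux (A12 layer invariant: conclusion = the crux BY NAME, no `Prop` hypotheses, placeholders only inside the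
declared stubs, used by name).
-/

noncomputable section

open Set MeasureTheory Filter Topology
open Literature.Analysis.FluidPDE Literature.Analysis.FluidPDE.FourierNS
open Summit.NavierStokesRegularity.NavierStokesRegularity.Theorems.EnvelopeBound

namespace Summit.NavierStokesRegularity.NavierStokesRegularity.Cruxes.EnvelopeBound.Birth

set_option linter.unusedVariables false
set_option linter.dupNamespace false

/-! ### The stubs -/

/-- **stub 1 — `stub_mildUnique` (M, known-type): uniqueness of Fourier-side mild solutions** — LANDED (p146654),
a reference to the tree theorem `Registered.stub_mildUnique`. -/
theorem stub_mildUnique :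
    ∀ (c : ℝ) (K₀ : ℕ) (t₀ T T' : ℝ)
      (V W : ℝ → EuclideanSpace ℝ (Fin 3) → Fin 3 → ℂ),
      Literature.Analysis.FluidPDE.FourierNS.IsFourierMild c K₀ t₀ T V →
      Literature.Analysis.FluidPDE.FourierNS.IsFourierMild c K₀ t₀ T' W →
      V t₀ = W t₀ →
      ∀ t : ℝ, t₀ ≤ t → t ≤ T → t ≤ T' → V t = W t :=
  Registered.stub_mildUnique

/-- **stub 2 — `stub_energyOfUnique` (M, known-type): uniqueness ⇒ the energy inequality of Fourier-side mild
solutions** — LANDED (p146706), a reference to the tree theorem `Registered.stub_energyOfUnique`. -/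
theorem stub_energyOfUnique :
    (∀ (c : ℝ) (K₀ : ℕ) (t₀ T T' : ℝ)
      (V W : ℝ → EuclideanSpace ℝ (Fin 3) → Fin 3 → ℂ),
      Literature.Analysis.FluidPDE.FourierNS.IsFourierMild c K₀ t₀ T V →
      Literature.Analysis.FluidPDE.FourierNS.IsFourierMild c K₀ t₀ T' W →
      V t₀ = W t₀ →
      ∀ t : ℝ, t₀ ≤ t → t ≤ T → t ≤ T' → V t = W t) →
    ∀ (c : ℝ) (K₀ : ℕ) (t₀ t₁ : ℝ) (V : ℝ → EuclideanSpace ℝ (Fin 3) → Fin 3 → ℂ),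
      Literature.Analysis.FluidPDE.FourierNS.IsFourierMild c K₀ t₀ t₁ V →
      ∀ t ∈ Set.Icc t₀ t₁, ∫ η, ∑ l, ‖V t η l‖ ^ 2 ≤ ∫ η, ∑ l, ‖V t₀ η l‖ ^ 2 :=
  Registered.stub_energyOfUnique

/-- **stub 3 — `stub_energyCancellation` (M, known-type, NEW in r3) — LANDED p159713 (`Leray.stub_energyCancellation`):
the energy pairing of the projected nonlinearity vanishes.** For a coefficient field `v : ℝ³ → ℂ³` on frequency space which is continuous, decays
to every polynomial order, is divergence free on the Fourier side (`∑ₗ ξₗ vₗ(ξ) = 0`) and conjugation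
symmetric (`v(-ξ) = conj v(ξ)`, reality of the synthesis), `Re ∫ ∑ₗ conj(vₗ(ξ)) N(v,v)(ξ)ₗ dξ = 0` — the
Fourier form of `∫ u·ℙ[(u·∇)u] = ∫ u·(u·∇)u = 0`. Mechanism: the projector part of `m_{jkl}` pairs with
`∑ₗ ξₗ conj(vₗ) = 0`; the frequency Leibniz rule `ξⱼ(vⱼ⋆vₖ) = (ηⱼvⱼ)⋆vₖ + vⱼ⋆(ηⱼvₖ)` and `divFree` kill the
first half; commutativity of `⋆`, ONE Fubini and `conjSymm` (`∫conj(vₖ(ξ))vⱼ(ξ-ζ)dξ = conj((vₖ⋆vⱼ)(ζ))`) show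
that `S' = ∑ⱼₖ∫conj(vₖ)ξⱼ(vⱼ⋆vₖ)` equals its own conjugate, i.e. is REAL, and the pairing is `-2πi·S'`.
This is the one identity of the true equation that is not a magnitude bound (it fails for the cheap equation).
Leans on: `NSFourierAPriori.coord_mul_fconv`, `fconv_comm`, `NSFourierBilinear.fconv_conj_symm`,
`nonlin_apply`, `lerayDerivSymbol_apply`, Mathlib `integral_integral_swap`, `integral_conj`,
`integral_neg_eq_self`/`integral_comp_neg`. -/
theorem stub_energyCancellation :
    ∀ (v : EuclideanSpace ℝ (Fin 3) → Fin 3 → ℂ), Continuous v →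
      (∀ K : ℕ, ∃ A : ℝ, Literature.Analysis.FluidPDE.FourierNS.HasDecay K A v) →
      (∀ ξ : EuclideanSpace ℝ (Fin 3), ∑ l, ((ξ l : ℝ) : ℂ) * v ξ l = 0) →
      (∀ (ξ : EuclideanSpace ℝ (Fin 3)) (l : Fin 3), v (-ξ) l = (starRingEnd ℂ) (v ξ l)) →
      ∫ ξ, ∑ l, ((starRingEnd ℂ) (v ξ l) *
        Literature.Analysis.FluidPDE.FourierNS.nonlin v v ξ l).re = 0 :=
  Leray.stub_energyCancellation

/-- **stub 4 — `stub_productionL2` (M, known-type, NEW in r3) — LANDED p159594 (`Leray.stub_productionL2`): the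
enstrophy production against the `L²` bound of the nonlinearity.** There is an absolute `K₁ ≥ 0` such that for every continuous coefficient field
`v : ℝ³ → ℂ³` with decay of every order,
`|∫ ‖ξ‖² ∑ₗ Re(conj(vₗ) N(v,v)ₗ)| ≤ K₁ · D^{1/2} · (∫‖v‖) · Ens^{1/2}`,
`Ens = ∫‖ξ‖²∑ₗ‖vₗ‖²`, `D = ∫‖ξ‖⁴∑ₗ‖vₗ‖²` — the Fourier form of `|∫(u·∇u)·Δu| ≤ ‖Δu‖₂ ‖û‖₁ ‖∇u‖₂`.
Mechanism: Cauchy–Schwarz in `ξ` (`∑ₗ‖vₗ‖‖Nₗ‖ ≤ (∑ₗ‖vₗ‖)‖N‖`, `(∑ₗ‖vₗ‖)² ≤ 3∑ₗ‖vₗ‖²`,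
`NSFourierAPriori.sq_integral_mul_le_of_integrable`), then the tree's
`NSFourierAPriori.eLpNorm_nonlin_le : ‖N(v,v)‖_{L²} ≤ C_ι M ‖‖ξ‖v‖_{L²}` with the synthesis bound
`M = ∫‖v‖` (`|𝓕vₗ(x)| ≤ ‖vₗ‖_{L¹}`, `VectorFourier.norm_fourierIntegral_le_integral_norm`), and
`‖v ξ‖² ≤ ∑ₗ‖v ξ l‖²` (`norm_sq_le_sum_norm_sq`); `K₁ = √3·nonlinL2Const (Fin 3)`. The `eLpNorm` ↔ Bochner
conversions follow `Registered.integral_sum_norm_sq_eq_toReal` / `NSFourierAPriori.eLpNorm_two_sq`. -/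
theorem stub_productionL2 :
    ∃ K₁ : ℝ, 0 ≤ K₁ ∧ ∀ (v : EuclideanSpace ℝ (Fin 3) → Fin 3 → ℂ), Continuous v →
      (∀ K : ℕ, ∃ A : ℝ, Literature.Analysis.FluidPDE.FourierNS.HasDecay K A v) →
      |∫ ξ, ‖ξ‖ ^ 2 * ∑ l, ((starRingEnd ℂ) (v ξ l) *
          Literature.Analysis.FluidPDE.FourierNS.nonlin v v ξ l).re| ≤
        K₁ * (∫ ξ, ‖ξ‖ ^ 4 * ∑ l, ‖v ξ l‖ ^ 2) ^ (1 / 2 : ℝ) * (∫ ξ, ‖v ξ‖) *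
          (∫ ξ, ‖ξ‖ ^ 2 * ∑ l, ‖v ξ l‖ ^ 2) ^ (1 / 2 : ℝ) :=
  Leray.stub_productionL2

/-- **stub 5 — `stub_agmonL1` (M, known-type, NEW in r3) — LANDED p159370 (`Leray.stub_agmonL1`): the Fourier-side Agmon inequality.** There is
an absolute `K₂ ≥ 0` such that for every continuous `v : ℝ³ → ℂ³` with decay of every order and every
`ρ > 0`, `∫‖v‖ ≤ K₂ (ρ^{1/2} Ens^{1/2} + ρ^{-1/2} D^{1/2})` (`Ens`, `D` as in stub 4) — the Fourier form of
`‖u‖_∞ ≤ ‖û‖₁ ≲ ‖∇u‖₂^{1/2}‖Δu‖₂^{1/2}` before optimising `ρ`. Mechanism: split at radius `ρ`;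
Cauchy–Schwarz on the ball with `∫_{‖ξ‖<ρ}‖ξ‖⁻² = 4πρ` (`Registered.integral_ball_inv_norm_sq_le`, p150147)
and on the tail with `∫_{‖ξ‖≥ρ}‖ξ‖⁻⁴ = 4π/ρ` (`Registered.integral_tail_inv_norm_four_le`);
`‖v ξ‖² ≤ ∑ₗ‖v ξ l‖²`; `K₂ = 2√π`. -/
theorem stub_agmonL1 :
    ∃ K₂ : ℝ, 0 ≤ K₂ ∧ ∀ (v : EuclideanSpace ℝ (Fin 3) → Fin 3 → ℂ), Continuous v →
      (∀ K : ℕ, ∃ A : ℝ, Literature.Analysis.FluidPDE.FourierNS.HasDecay K A v) →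
      ∀ ρ : ℝ, 0 < ρ →
        ∫ ξ, ‖v ξ‖ ≤ K₂ * (ρ ^ (1 / 2 : ℝ) * (∫ ξ, ‖ξ‖ ^ 2 * ∑ l, ‖v ξ l‖ ^ 2) ^ (1 / 2 : ℝ) +
          ρ ^ (-(1 / 2) : ℝ) * (∫ ξ, ‖ξ‖ ^ 4 * ∑ l, ‖v ξ l‖ ^ 2) ^ (1 / 2 : ℝ)) :=
  Leray.stub_agmonL1

/-- **stub 6 — `stub_farFromLeray` (XL, OPEN — the heart of the crux in r3).** For every `ν > 0`, Clay datum
`u₀` and enstrophy threshold `ω > 0` there is `C = C(ν,u₀,ω)` such that along EVERY Fourier-side mild solution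
`V` from the Fourier datum `a` on any `[0,T]`, at every time `t ∈ [0,T]` within the a-priori horizon
`t ≤ E₀/(2cω)` (`E₀ = ∫∑ₗ‖aₗ‖²`, `c = 4π²ν`; forced by the energy identity, see `far_horizon`) up to which the
Fourier enstrophy has stayed `≥ ω` (`∀ r ∈ [0,t], ω ≤ ∫‖ξ‖²∑ₗ‖V(r,ξ)ₗ‖²`), the critical envelope is
bounded: `‖ξ‖²‖V t ξ‖ ≤ C`. The crux on the bounded Leray horizon, stated intrinsically: NO OVERSHOOT OF THE
CRITICAL ENVELOPE WHILE THE FLOW IS OUTSIDE LERAY'S ABSORBING BALL `E·Ens ≤ θc⁴`. Equivalent to the crux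
given stubs 1–5 (this file proves ⇐; ⇒ is `Registered.highFrequencyBranch_of_envelopeBound`-trivial with
`T₀ := E₀/(2cω)`). Why plausibly true: implied by Clay (A). Why it might fail: exactly the crux's failure mode
(a singularity with unbounded `PM²` envelope before absorption). Barriers: the cut is invisible to the cheap
equation (no energy identity there) and to one-sided complex data (no `conjSymm`); but the energy identity is
supercritical, so a proof must still use the sign structure of the true symbol AT THE CRITICAL LEVEL inside
the window `[0, E₀/(2cω)]` — the route's mechanism (signed cascade) has to enter here. -/
theorem stub_farFromLeray :
    ∀ ν : ℝ, 0 < ν →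
      ∀ (u₀ : EuclideanSpace ℝ (Fin 3) → EuclideanSpace ℝ (Fin 3)) (hu : ContDiff ℝ (⊤ : ℕ∞) u₀)
        (hd : Literature.Analysis.FluidPDE.HasRapidSpatialDecay u₀),
        Literature.Analysis.FluidPDE.NSWave0.IsDivFree u₀ →
      ∀ ω : ℝ, 0 < ω → ∃ C : ℝ, ∀ T : ℝ, ∀ V : ℝ → EuclideanSpace ℝ (Fin 3) → Fin 3 → ℂ,
        Literature.Analysis.FluidPDE.FourierNS.IsFourierMild (4 * Real.pi ^ 2 * ν) 4 0 T V →
        V 0 = Literature.Analysis.FluidPDE.FourierNS.fourierData hu hd →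
        ∀ t ∈ Set.Icc 0 T,
          t ≤ (∫ ξ, ∑ l, ‖Literature.Analysis.FluidPDE.FourierNS.fourierData hu hd ξ l‖ ^ 2) /
            (2 * (4 * Real.pi ^ 2 * ν) * ω) →
          (∀ r ∈ Set.Icc 0 t, ω ≤ ∫ ξ, ‖ξ‖ ^ 2 * ∑ l, ‖V r ξ l‖ ^ 2) →
          ∀ ξ : EuclideanSpace ℝ (Fin 3), ‖ξ‖ ^ 2 * ‖V t ξ‖ ≤ C := by
  sorry

/-! ### Integrability of the quadratic functionals along a mild solution -/

section Integrability

variable {c t₀ t₁ : ℝ} {K₀ : ℕ} {V : ℝ → EuclideanSpace ℝ (Fin 3) → Fin 3 → ℂ}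

/-- The component energy density `∑ₗ ‖V(r,ξ)ₗ‖²` is integrable. -/
theorem integrable_sumSq (h : IsFourierMild c K₀ t₀ t₁ V) (r : ℝ) :
    Integrable fun ξ : EuclideanSpace ℝ (Fin 3) => ∑ l, ‖V r ξ l‖ ^ 2 := by
  obtain ⟨A, hA⟩ := h.decay (0 + K₀)
  have hb : ∀ ξ : EuclideanSpace ℝ (Fin 3), |(fun _ => (1:ℝ)) ξ| ≤ (1 + ‖ξ‖) ^ 0 := fun ξ => by simp
  have hmeas : AEStronglyMeasurable
      (fun ξ : EuclideanSpace ℝ (Fin 3) => (fun _ => (1:ℝ)) ξ * ∑ l, ‖V r ξ l‖ ^ 2) volume :=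
    (continuous_const.mul (continuous_finsetSum _ fun l _ =>
      ((continuous_apply l).comp (h.continuous_slice r)).norm.pow 2)).aestronglyMeasurable
  have h1 : Integrable (fun ξ : EuclideanSpace ℝ (Fin 3) => (fun _ => (1:ℝ)) ξ * ∑ l, ‖V r ξ l‖ ^ 2) :=
    (((integrable_inv_one_add_norm_pow (finrank_lt_of_card_lt h.hK₀)).const_mul
      (Fintype.card (Fin 3) * A ^ 2)).mono' hmeas
      (Eventually.of_forall fun ξ => Leray.norm_weightedSq_le hb hA r ξ))
  simpa using h1

/-- The weighted densities `‖ξ‖ⁿ ∑ₗ ‖V(r,ξ)ₗ‖²` are integrable. -/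
theorem integrable_pow_mul_sumSq (h : IsFourierMild c K₀ t₀ t₁ V) (n : ℕ) (r : ℝ) :
    Integrable fun ξ : EuclideanSpace ℝ (Fin 3) => ‖ξ‖ ^ n * ∑ l, ‖V r ξ l‖ ^ 2 := by
  obtain ⟨A, hA⟩ := h.decay (n + K₀)
  have hb : ∀ ξ : EuclideanSpace ℝ (Fin 3), |‖ξ‖ ^ n| ≤ (1 + ‖ξ‖) ^ n := fun ξ => by
    rw [abs_of_nonneg (by positivity)]
    exact pow_le_pow_left₀ (norm_nonneg _) (by linarith [norm_nonneg ξ]) n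
  exact (((integrable_inv_one_add_norm_pow (finrank_lt_of_card_lt h.hK₀)).const_mul
    (Fintype.card (Fin 3) * A ^ 2)).mono'
    (((continuous_norm.pow n).mul (continuous_finsetSum _ fun l _ =>
      ((continuous_apply l).comp (h.continuous_slice r)).norm.pow 2)).aestronglyMeasurable)
    (Eventually.of_forall fun ξ => Leray.norm_weightedSq_le hb hA r ξ))

/-- **Cauchy–Schwarz: `Ens² ≤ E · D`** (`‖ξ‖²∑‖Vₗ‖² = √(∑‖Vₗ‖²) · ‖ξ‖²√(∑‖Vₗ‖²)` and
`sq_integral_mul_le_of_integrable`). -/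
theorem enstrophy_sq_le (h : IsFourierMild c K₀ t₀ t₁ V) (r : ℝ) :
    (∫ ξ, ‖ξ‖ ^ 2 * ∑ l, ‖V r ξ l‖ ^ 2) ^ 2 ≤
      (∫ ξ, ∑ l, ‖V r ξ l‖ ^ 2) * ∫ ξ, ‖ξ‖ ^ 4 * ∑ l, ‖V r ξ l‖ ^ 2 := by
  set S : EuclideanSpace ℝ (Fin 3) → ℝ := fun ξ => ∑ l, ‖V r ξ l‖ ^ 2 with hS
  have hS0 : ∀ ξ, 0 ≤ S ξ := fun ξ => Finset.sum_nonneg fun l _ => sq_nonneg _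
  set f : EuclideanSpace ℝ (Fin 3) → ℝ := fun ξ => Real.sqrt (S ξ) with hf
  set g : EuclideanSpace ℝ (Fin 3) → ℝ := fun ξ => ‖ξ‖ ^ 2 * Real.sqrt (S ξ) with hg
  have hf2 : ∀ ξ, f ξ ^ 2 = S ξ := fun ξ => Real.sq_sqrt (hS0 ξ)
  have hg2 : ∀ ξ, g ξ ^ 2 = ‖ξ‖ ^ 4 * S ξ := fun ξ => by
    simp only [hg]; rw [mul_pow, Real.sq_sqrt (hS0 ξ)]; ring
  have hfg : ∀ ξ, f ξ * g ξ = ‖ξ‖ ^ 2 * S ξ := fun ξ => by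
    simp only [hf, hg]
    calc Real.sqrt (S ξ) * (‖ξ‖ ^ 2 * Real.sqrt (S ξ)) = ‖ξ‖ ^ 2 * (Real.sqrt (S ξ)) ^ 2 := by ring
      _ = ‖ξ‖ ^ 2 * S ξ := by rw [Real.sq_sqrt (hS0 ξ)]
  have h1 := sq_integral_mul_le_of_integrable (μ := volume) (f := f) (g := g)
    ((integrable_sumSq h r).congr (Eventually.of_forall fun ξ => (hf2 ξ).symm))
    ((integrable_pow_mul_sumSq h 4 r).congr (Eventually.of_forall fun ξ => (hg2 ξ).symm))
    ((integrable_pow_mul_sumSq h 2 r).congr (Eventually.of_forall fun ξ => (hfg ξ).symm))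
  simp only [hf2, hg2, hfg] at h1
  exact h1

end Integrability

/-! ### The energy identity with dissipation, and the a-priori horizon of the far regime -/

section Energy

variable {c t₀ t₁ : ℝ} {K₀ : ℕ} {V : ℝ → EuclideanSpace ℝ (Fin 3) → Fin 3 → ℂ}

/-- **The energy identity with dissipation** (from `stub_energyCancellation`): for `V` mild on `[t₀,t₁]` and
`t₀ ≤ s ≤ t ≤ t₁`, `E(t) + 2c ∫ₛᵗ Ens = E(s)`. Proof: at interior times `E' = -2c·Ens − 2∫∑Re(conj Vₗ Nₗ)`
(`Leray.hasDerivAt_energy`, landed) and the pairing vanishes (stub 3 on the slice); `E` is continuous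
(`Leray.continuous_energy`), `Ens` is continuous, and the fundamental theorem of calculus applies on `[s,t]`. -/
theorem energyDissip (h : IsFourierMild c K₀ t₀ t₁ V) {s t : ℝ} (hs : t₀ ≤ s) (hst : s ≤ t) (ht : t ≤ t₁) :
    (∫ ξ, ∑ l, ‖V t ξ l‖ ^ 2) + 2 * c * (∫ r in s..t, ∫ ξ, ‖ξ‖ ^ 2 * ∑ l, ‖V r ξ l‖ ^ 2) =
      ∫ ξ, ∑ l, ‖V s ξ l‖ ^ 2 := by
  have hderiv : ∀ r ∈ Ioo s t, HasDerivAt (fun r => ∫ ξ, ∑ l, ‖V r ξ l‖ ^ 2)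
      (-(2 * c) * ∫ ξ, ‖ξ‖ ^ 2 * ∑ l, ‖V r ξ l‖ ^ 2) r := by
    intro r hr
    have hr' : r ∈ Ioo t₀ t₁ := ⟨lt_of_le_of_lt hs hr.1, lt_of_lt_of_le hr.2 ht⟩
    have hd := (Leray.hasDerivAt_energy h hr').2
    have hcanc := stub_energyCancellation (V r) (h.continuous_slice r)
      (fun K => (h.decay K).imp fun A hA => hA r) (h.divFree r) (h.conjSymm r)
    rw [hcanc, mul_zero, sub_zero] at hd
    exact hd
  have hcont : ContinuousOn (fun r => ∫ ξ, ∑ l, ‖V r ξ l‖ ^ 2) (Icc s t) :=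
    (Leray.continuous_energy h).continuousOn
  have hint : IntervalIntegrable (fun r => -(2 * c) * ∫ ξ, ‖ξ‖ ^ 2 * ∑ l, ‖V r ξ l‖ ^ 2) volume s t :=
    (continuous_const.mul (Leray.continuous_enstrophy h)).intervalIntegrable _ _
  have key := intervalIntegral.integral_eq_sub_of_hasDerivAt_of_le hst hcont hderiv hint
  rw [intervalIntegral.integral_const_mul] at key
  linarith

/-- **The a-priori horizon of the far regime.** Along a mild `V` on `[0,T]`, if the enstrophy stays `≥ ω > 0`
on `[0,t]` then `t ≤ E(0)/(2cω)`: `2cωt ≤ 2c∫₀ᵗ Ens = E(0) − E(t) ≤ E(0)`. -/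
theorem far_horizon (h : IsFourierMild c K₀ 0 t₁ V) {ω : ℝ} (hω : 0 < ω) {t : ℝ} (ht : t ∈ Icc 0 t₁)
    (hfar : ∀ r ∈ Icc 0 t, ω ≤ ∫ ξ, ‖ξ‖ ^ 2 * ∑ l, ‖V r ξ l‖ ^ 2) :
    t ≤ (∫ ξ, ∑ l, ‖V 0 ξ l‖ ^ 2) / (2 * c * ω) := by
  have hc : 0 < c := h.hc
  have hid := energyDissip h le_rfl ht.1 ht.2
  have hEt : 0 ≤ ∫ ξ, ∑ l, ‖V t ξ l‖ ^ 2 :=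
    integral_nonneg fun ξ => Finset.sum_nonneg fun l _ => sq_nonneg _
  have hlow : ω * t ≤ ∫ r in (0:ℝ)..t, ∫ ξ, ‖ξ‖ ^ 2 * ∑ l, ‖V r ξ l‖ ^ 2 := by
    have h1 : ∫ r in (0:ℝ)..t, ω = ω * t := by simp [mul_comm]
    rw [← h1]
    exact intervalIntegral.integral_mono_on ht.1 (by simp)
      ((Leray.continuous_enstrophy h).intervalIntegrable _ _) fun r hr => hfar r hr
  rw [le_div_iff₀ (by positivity)]
  nlinarith [mul_le_mul_of_nonneg_left hlow (by positivity : (0:ℝ) ≤ 2 * c)]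

end Energy

/-! ### The enstrophy balance with Leray's production bound -/

/-- Powers bookkeeping: for `x > 0`, `x^{1/2} = x^{1/4} x^{1/4}` and `x^{3/4} = x^{1/2} x^{1/4}`. -/
theorem rpow_half_eq {x : ℝ} (hx : 0 < x) : x ^ (1 / 2 : ℝ) = x ^ (1 / 4 : ℝ) * x ^ (1 / 4 : ℝ) := by
  rw [← Real.rpow_add hx]; norm_num

theorem rpow_three_quarters_eq {x : ℝ} (hx : 0 < x) :
    x ^ (3 / 4 : ℝ) = x ^ (1 / 2 : ℝ) * x ^ (1 / 4 : ℝ) := by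
  rw [← Real.rpow_add hx]; norm_num

/-- **The enstrophy balance** (from `stub_productionL2` and `stub_agmonL1`): there is an absolute `K ≥ 0` such
that for every Fourier-mild `V` on `[t₀,t₁]` and every interior `t`, `Ens' (t) = -2c·D(t) + P` with
`|P| ≤ K·Ens(t)^{3/4}·D(t)^{3/4}`. Proof: `Ens' = -2cD − 2Pr` (`Leray.hasDerivAt_enstrophy`, landed);
`|Pr| ≤ K₁ D^{1/2} M Ens^{1/2}` with `M = ∫‖V(t)‖` (stub 4) and `M ≤ K₂(ρ^{1/2}Ens^{1/2} + ρ^{-1/2}D^{1/2})`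
(stub 5) at `ρ = (D/Ens)^{1/2}`, i.e. `M ≤ 2K₂ Ens^{1/4}D^{1/4}`; the degenerate cases `D = 0` / `Ens = 0` give
`Pr = 0` directly. `K = 4K₁K₂`. -/
theorem enstrophyBalance :
    ∃ K : ℝ, 0 ≤ K ∧ ∀ (c : ℝ) (K₀ : ℕ) (t₀ t₁ : ℝ) (V : ℝ → EuclideanSpace ℝ (Fin 3) → Fin 3 → ℂ),
      Literature.Analysis.FluidPDE.FourierNS.IsFourierMild c K₀ t₀ t₁ V →
      ∀ t ∈ Set.Ioo t₀ t₁, ∃ P : ℝ,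
        HasDerivAt (fun r => ∫ ξ, ‖ξ‖ ^ 2 * ∑ l, ‖V r ξ l‖ ^ 2)
          (-(2 * c) * (∫ ξ, ‖ξ‖ ^ 4 * ∑ l, ‖V t ξ l‖ ^ 2) + P) t ∧
        |P| ≤ K * (∫ ξ, ‖ξ‖ ^ 2 * ∑ l, ‖V t ξ l‖ ^ 2) ^ (3 / 4 : ℝ) *
          (∫ ξ, ‖ξ‖ ^ 4 * ∑ l, ‖V t ξ l‖ ^ 2) ^ (3 / 4 : ℝ) := by
  obtain ⟨K₁, hK₁, hprod⟩ := stub_productionL2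
  obtain ⟨K₂, hK₂, hagm⟩ := stub_agmonL1
  refine ⟨4 * K₁ * K₂, by positivity, ?_⟩
  intro c K₀ t₀ t₁ V h t ht
  have hdec : ∀ K : ℕ, ∃ A : ℝ, HasDecay K A (V t) := fun K => (h.decay K).imp fun A hA => hA t
  set Ens : ℝ := ∫ ξ, ‖ξ‖ ^ 2 * ∑ l, ‖V t ξ l‖ ^ 2 with hEns
  set D : ℝ := ∫ ξ, ‖ξ‖ ^ 4 * ∑ l, ‖V t ξ l‖ ^ 2 with hD
  set M : ℝ := ∫ ξ, ‖V t ξ‖ with hM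
  set Pr : ℝ := ∫ ξ, ‖ξ‖ ^ 2 * ∑ l, ((starRingEnd ℂ) (V t ξ l) * nonlin (V t) (V t) ξ l).re with hPr
  have hEns0 : 0 ≤ Ens := integral_nonneg fun ξ => by positivity
  have hD0 : 0 ≤ D := integral_nonneg fun ξ => by positivity
  have hM0 : 0 ≤ M := integral_nonneg fun ξ => norm_nonneg _
  have hder := (Leray.hasDerivAt_enstrophy h ht).2
  refine ⟨-2 * Pr, ?_, ?_⟩
  · convert hder using 1; simp only [hPr, hD]; ring
  have hPrle : |Pr| ≤ K₁ * D ^ (1 / 2 : ℝ) * M * Ens ^ (1 / 2 : ℝ) := hprod (V t) (h.continuous_slice t) hdec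
  have habs : |(-2 : ℝ) * Pr| = 2 * |Pr| := by rw [abs_mul, abs_neg, abs_two]
  rw [habs]
  have hRHS0 : 0 ≤ 4 * K₁ * K₂ * Ens ^ (3 / 4 : ℝ) * D ^ (3 / 4 : ℝ) := by positivity
  rcases eq_or_lt_of_le hD0 with hD00 | hDpos
  · -- `D = 0`: the production vanishes
    have : |Pr| ≤ 0 := by
      calc |Pr| ≤ K₁ * D ^ (1 / 2 : ℝ) * M * Ens ^ (1 / 2 : ℝ) := hPrle
        _ = 0 := by rw [← hD00, Real.zero_rpow (by norm_num)]; ring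
    linarith
  rcases eq_or_lt_of_le hEns0 with hE00 | hEnspos
  · -- `Ens = 0`: the production vanishes
    have : |Pr| ≤ 0 := by
      calc |Pr| ≤ K₁ * D ^ (1 / 2 : ℝ) * M * Ens ^ (1 / 2 : ℝ) := hPrle
        _ = 0 := by rw [← hE00, Real.zero_rpow (by norm_num)]; ring
    linarith
  -- both positive: optimise `ρ = (D/Ens)^{1/2}`
  set ρ : ℝ := (D / Ens) ^ (1 / 2 : ℝ) with hρ
  have hρpos : 0 < ρ := Real.rpow_pos_of_pos (div_pos hDpos hEnspos) _
  have hMle := hagm (V t) (h.continuous_slice t) hdec ρ hρpos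
  -- `ρ^{1/2} Ens^{1/2} = D^{1/4} Ens^{1/4}` and `ρ^{-1/2} D^{1/2} = D^{1/4} Ens^{1/4}`
  have hq1 : ρ ^ (1 / 2 : ℝ) = D ^ (1 / 4 : ℝ) / Ens ^ (1 / 4 : ℝ) := by
    rw [hρ, ← Real.rpow_mul (div_pos hDpos hEnspos).le, Real.div_rpow hDpos.le hEnspos.le]
    norm_num
  have hq2 : ρ ^ (-(1 / 2) : ℝ) = Ens ^ (1 / 4 : ℝ) / D ^ (1 / 4 : ℝ) := by
    rw [hρ, ← Real.rpow_mul (div_pos hDpos hEnspos).le,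
      show (1 / 2 : ℝ) * -(1 / 2) = -(1 / 4) by norm_num, Real.rpow_neg (div_pos hDpos hEnspos).le,
      Real.div_rpow hDpos.le hEnspos.le, inv_div]
  have hE4 : 0 < Ens ^ (1 / 4 : ℝ) := Real.rpow_pos_of_pos hEnspos _
  have hD4 : 0 < D ^ (1 / 4 : ℝ) := Real.rpow_pos_of_pos hDpos _
  have e1 : ρ ^ (1 / 2 : ℝ) * Ens ^ (1 / 2 : ℝ) = D ^ (1 / 4 : ℝ) * Ens ^ (1 / 4 : ℝ) := by
    rw [hq1, rpow_half_eq hEnspos]; field_simp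
  have e2 : ρ ^ (-(1 / 2) : ℝ) * D ^ (1 / 2 : ℝ) = D ^ (1 / 4 : ℝ) * Ens ^ (1 / 4 : ℝ) := by
    rw [hq2, rpow_half_eq hDpos]; field_simp
  have hM2 : M ≤ 2 * K₂ * (D ^ (1 / 4 : ℝ) * Ens ^ (1 / 4 : ℝ)) := by
    calc M ≤ K₂ * (ρ ^ (1 / 2 : ℝ) * Ens ^ (1 / 2 : ℝ) + ρ ^ (-(1 / 2) : ℝ) * D ^ (1 / 2 : ℝ)) := hMle
      _ = 2 * K₂ * (D ^ (1 / 4 : ℝ) * Ens ^ (1 / 4 : ℝ)) := by rw [e1, e2]; ring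
  calc 2 * |Pr| ≤ 2 * (K₁ * D ^ (1 / 2 : ℝ) * M * Ens ^ (1 / 2 : ℝ)) := by linarith
    _ ≤ 2 * (K₁ * D ^ (1 / 2 : ℝ) * (2 * K₂ * (D ^ (1 / 4 : ℝ) * Ens ^ (1 / 4 : ℝ))) * Ens ^ (1 / 2 : ℝ)) := by
        gcongr
    _ = 4 * K₁ * K₂ * (Ens ^ (1 / 2 : ℝ) * Ens ^ (1 / 4 : ℝ)) * (D ^ (1 / 2 : ℝ) * D ^ (1 / 4 : ℝ)) := by ring
    _ = 4 * K₁ * K₂ * Ens ^ (3 / 4 : ℝ) * D ^ (3 / 4 : ℝ) := by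
        rw [← rpow_three_quarters_eq hEnspos, ← rpow_three_quarters_eq hDpos]

/-! ### Leray's lemma from the enstrophy balance -/

/-- Algebra of Leray's lemma: with `K' ≥ 0`, `Ens, E, D ≥ 0`, `Ens² ≤ E·D` and `K'⁴·(E·Ens) ≤ 16c⁴`
(`c ≥ 0`), the production is dominated by the dissipation: `K' Ens^{3/4} D^{3/4} ≤ 2c D`. -/
theorem production_le_dissipation {K' Ens E D c : ℝ} (hK' : 0 ≤ K') (hEns : 0 ≤ Ens) (hE : 0 ≤ E)
    (hD : 0 ≤ D) (hc : 0 ≤ c) (hCS : Ens ^ 2 ≤ E * D) (hsmall : K' ^ 4 * (E * Ens) ≤ 16 * c ^ 4) :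
    K' * Ens ^ (3 / 4 : ℝ) * D ^ (3 / 4 : ℝ) ≤ 2 * c * D := by
  -- `K'⁴ Ens³ ≤ 16 c⁴ D`
  have h1 : K' ^ 4 * Ens ^ 3 ≤ 16 * c ^ 4 * D := by
    calc K' ^ 4 * Ens ^ 3 = K' ^ 4 * Ens * Ens ^ 2 := by ring
      _ ≤ K' ^ 4 * Ens * (E * D) := mul_le_mul_of_nonneg_left hCS (by positivity)
      _ = K' ^ 4 * (E * Ens) * D := by ring
      _ ≤ 16 * c ^ 4 * D := mul_le_mul_of_nonneg_right hsmall hD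
  -- fourth roots: `K' Ens^{3/4} ≤ 2c D^{1/4}`
  have hroot : K' * Ens ^ (3 / 4 : ℝ) ≤ 2 * c * D ^ (1 / 4 : ℝ) := by
    have ha : 0 ≤ K' * Ens ^ (3 / 4 : ℝ) := by positivity
    have hb : 0 ≤ 2 * c * D ^ (1 / 4 : ℝ) := by positivity
    refine (pow_le_pow_iff_left₀ ha hb (by norm_num : (4:ℕ) ≠ 0)).1 ?_
    have e1 : (K' * Ens ^ (3 / 4 : ℝ)) ^ 4 = K' ^ 4 * Ens ^ 3 := by
      rw [mul_pow]
      congr 1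
      rw [← Real.rpow_natCast (Ens ^ (3 / 4 : ℝ)) 4, ← Real.rpow_mul hEns]
      norm_num
    have e2 : (2 * c * D ^ (1 / 4 : ℝ)) ^ 4 = 16 * c ^ 4 * D := by
      rw [mul_pow, mul_pow]
      have : (D ^ (1 / 4 : ℝ)) ^ 4 = D := by
        rw [← Real.rpow_natCast (D ^ (1 / 4 : ℝ)) 4, ← Real.rpow_mul hD]
        norm_num
      rw [this]; norm_num
    rw [e1, e2]; exact h1
  calc K' * Ens ^ (3 / 4 : ℝ) * D ^ (3 / 4 : ℝ) ≤ 2 * c * D ^ (1 / 4 : ℝ) * D ^ (3 / 4 : ℝ) :=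
        mul_le_mul_of_nonneg_right hroot (by positivity)
    _ = 2 * c * (D ^ (1 / 4 : ℝ) * D ^ (3 / 4 : ℝ)) := by ring
    _ = 2 * c * D := by
        rw [← Real.rpow_add' hD (by norm_num : (1 / 4 : ℝ) + 3 / 4 ≠ 0)]
        norm_num

/-- **Leray's lemma (1934, §22) for Fourier-side mild solutions, from the balance stub.** There is an
absolute `θ > 0` such that for every Fourier-mild `V` on `[t₀,t₁]` and `s ∈ [t₀,t₁]`: if the scale-invariant
product (energy × enstrophy) satisfies `E(s)·Ens(s) ≤ θ c⁴` at time `s`, then the enstrophy never again exceeds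
`Ens(s)` on `[s,t₁]`. Proof: with `K` from `enstrophyBalance` (stubs 4–5), `θ := 8/(K+1)⁴`; the set
`{r | Ens(r) ≤ Ens(s)}` is closed (continuity of `Ens`, landed) and contains, with each of its points `x < t₁`,
a right-neighbourhood: at `x`, `E(x)Ens(x) ≤ E(s)Ens(s) ≤ θc⁴ < 16c⁴/(K+1)⁴` (energy inequality), which
persists strictly on some `[x,x+δ]` by continuity; there `Ens' = -2cD + P ≤ 0` (`production_le_dissipation`
with Cauchy–Schwarz `Ens² ≤ E·D`), so `Ens` is non-increasing on `[x,x+δ]` (mean value theorem). -/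
theorem leray_threshold :
    ∃ θ : ℝ, 0 < θ ∧ ∀ (c : ℝ) (K₀ : ℕ) (t₀ t₁ : ℝ) (V : ℝ → EuclideanSpace ℝ (Fin 3) → Fin 3 → ℂ),
      Literature.Analysis.FluidPDE.FourierNS.IsFourierMild c K₀ t₀ t₁ V →
      ∀ s ∈ Set.Icc t₀ t₁,
        (∫ ξ, ∑ l, ‖V s ξ l‖ ^ 2) * (∫ ξ, ‖ξ‖ ^ 2 * ∑ l, ‖V s ξ l‖ ^ 2) ≤ θ * c ^ 4 →
        ∀ t ∈ Set.Icc s t₁, (∫ ξ, ‖ξ‖ ^ 2 * ∑ l, ‖V t ξ l‖ ^ 2) ≤ ∫ ξ, ‖ξ‖ ^ 2 * ∑ l, ‖V s ξ l‖ ^ 2 := by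
  obtain ⟨K, hK0, hbal⟩ := enstrophyBalance
  set K' : ℝ := K + 1 with hK'
  have hK'pos : 0 < K' := by rw [hK']; linarith
  refine ⟨8 / K' ^ 4, by positivity, ?_⟩
  intro c K₀ t₀ t₁ V h s hs hsmall t ht
  have hc : 0 < c := h.hc
  -- the three functionals
  set Ens : ℝ → ℝ := fun r => ∫ ξ, ‖ξ‖ ^ 2 * ∑ l, ‖V r ξ l‖ ^ 2 with hEns
  set E : ℝ → ℝ := fun r => ∫ ξ, ∑ l, ‖V r ξ l‖ ^ 2 with hE
  set D : ℝ → ℝ := fun r => ∫ ξ, ‖ξ‖ ^ 4 * ∑ l, ‖V r ξ l‖ ^ 2 with hD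
  have hEns0 : ∀ r, 0 ≤ Ens r := fun r => integral_nonneg fun ξ => by positivity
  have hE0 : ∀ r, 0 ≤ E r := fun r => integral_nonneg fun ξ => Finset.sum_nonneg fun l _ => sq_nonneg _
  have hD0 : ∀ r, 0 ≤ D r := fun r => integral_nonneg fun ξ => by positivity
  have hEnsc : Continuous Ens := Leray.continuous_enstrophy h
  have hEc : Continuous E := Leray.continuous_energy h
  -- energy inequality from `s`
  have hEmono : ∀ r ∈ Icc s t₁, E r ≤ E s := fun r hr =>
    Registered.energyIneq c K₀ s t₁ V (h.mono hs.1 hs.2 le_rfl) r hr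
  -- the derivative is nonpositive wherever `E · Ens < 16 c⁴ / K'⁴`
  have hderiv : ∀ r ∈ Ioo t₀ t₁, E r * Ens r ≤ 16 * c ^ 4 / K' ^ 4 →
      DifferentiableAt ℝ Ens r ∧ deriv Ens r ≤ 0 := by
    intro r hr hsm
    obtain ⟨P, hP, hPb⟩ := hbal c K₀ t₀ t₁ V h r hr
    refine ⟨hP.differentiableAt, ?_⟩
    rw [hP.deriv]
    have hsm' : K' ^ 4 * (E r * Ens r) ≤ 16 * c ^ 4 := by
      rw [le_div_iff₀ (by positivity)] at hsm; linarith
    have hprod := production_le_dissipation hK'pos.le (hEns0 r) (hE0 r) (hD0 r) hc.le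
      (enstrophy_sq_le h r) hsm'
    have hPle : |P| ≤ 2 * c * D r := by
      calc |P| ≤ K * Ens r ^ (3 / 4 : ℝ) * D r ^ (3 / 4 : ℝ) := hPb
        _ ≤ K' * Ens r ^ (3 / 4 : ℝ) * D r ^ (3 / 4 : ℝ) := by
            gcongr; rw [hK']; linarith
        _ ≤ 2 * c * D r := hprod
    have := (abs_le.1 hPle).2
    show -(2 * c) * D r + P ≤ 0
    linarith
  -- the bootstrap
  set S : Set ℝ := {r | Ens r ≤ Ens s} with hSdef
  have hSclosed : IsClosed S := isClosed_le hEnsc continuous_const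
  have key : Icc s t₁ ⊆ S := by
    apply IsClosed.Icc_subset_of_forall_mem_nhdsWithin (hSclosed.inter isClosed_Icc) (le_refl (Ens s))
    rintro x ⟨hxS, hxs, hxt₁⟩
    -- at `x`: `E x · Ens x ≤ E s · Ens s ≤ 8c⁴/K'⁴ < 16c⁴/K'⁴`
    have hx1 : E x * Ens x < 16 * c ^ 4 / K' ^ 4 := by
      have h1 : E x * Ens x ≤ E s * Ens s :=
        mul_le_mul (hEmono x ⟨hxs, hxt₁.le⟩) hxS (hEns0 x) (hE0 s)
      have h2 : (8 / K' ^ 4) * c ^ 4 < 16 * c ^ 4 / K' ^ 4 := by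
        rw [div_mul_eq_mul_div, div_lt_div_iff_of_pos_right (by positivity)]
        nlinarith [pow_pos hc 4]
      linarith
    -- persists on a right-neighbourhood inside `(t₀, t₁)`
    have hcont : ContinuousAt (fun r => E r * Ens r) x := (hEc.mul hEnsc).continuousAt
    have hev : ∀ᶠ r in 𝓝 x, E r * Ens r < 16 * c ^ 4 / K' ^ 4 := hcont.eventually (gt_mem_nhds hx1)
    obtain ⟨δ, hδpos, hδ⟩ := Metric.eventually_nhds_iff.1 hev
    set δ' : ℝ := min (δ / 2) ((t₁ - x) / 2) with hδ'
    have hδ'pos : 0 < δ' := lt_min (by linarith) (by linarith)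
    have hδ'δ : δ' < δ := lt_of_le_of_lt (min_le_left _ _) (by linarith)
    have hδ't : x + δ' < t₁ := by
      have : δ' ≤ (t₁ - x) / 2 := min_le_right _ _
      linarith
    -- `Ens` is non-increasing on `[x, x + δ']`
    have hanti : AntitoneOn Ens (Icc x (x + δ')) := by
      apply antitoneOn_of_deriv_nonpos (convex_Icc _ _) hEnsc.continuousOn
      · intro r hr
        rw [interior_Icc] at hr
        have hr' : r ∈ Ioo t₀ t₁ := ⟨lt_of_le_of_lt hs.1 (lt_of_le_of_lt hxs hr.1), hr.2.trans hδ't⟩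
        have hsm : E r * Ens r ≤ 16 * c ^ 4 / K' ^ 4 := by
          refine (hδ (show dist r x < δ from ?_)).le
          rw [Real.dist_eq, abs_lt]; constructor <;> linarith [hr.1, hr.2]
        exact (hderiv r hr' hsm).1.differentiableWithinAt
      · intro r hr
        rw [interior_Icc] at hr
        have hr' : r ∈ Ioo t₀ t₁ := ⟨lt_of_le_of_lt hs.1 (lt_of_le_of_lt hxs hr.1), hr.2.trans hδ't⟩
        have hsm : E r * Ens r ≤ 16 * c ^ 4 / K' ^ 4 := by
          refine (hδ (show dist r x < δ from ?_)).le
          rw [Real.dist_eq, abs_lt]; constructor <;> linarith [hr.1, hr.2]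
        exact (hderiv r hr' hsm).2
    -- hence `[x, x+δ'] ⊆ S`, a right-neighbourhood of `x`
    have hsub : Icc x (x + δ') ⊆ S := fun r hr =>
      le_trans (hanti (left_mem_Icc.2 (by linarith)) hr hr.1) hxS
    exact mem_of_superset (Icc_mem_nhdsGT (by linarith)) hsub
  exact key ht

/-! ### Composition -/

/-- **Composition (the skeleton theorem).** The crux BY NAME from the registered stubs — see the module
docstring for the architecture: Leray's lemma (`leray_threshold`, from `stub_enstrophyBalance`) fixes the
enstrophy threshold `ω = θc⁴/(E₀+1)`; before the first time the enstrophy drops to `ω` the far stub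
`stub_farFromLeray` bounds the envelope; from that time on the enstrophy stays `≤ ω` and the landed
`Registered.envelope_le_of_enstrophy` (energy × enstrophy controls the critical envelope) bounds it. -/
theorem EnvelopeBound_of : Theses.FrozenSignCascade.EnvelopeBound := by
  intro ν hν u₀ hu hd hdiv T₀ hT₀
  obtain ⟨θ, hθ, hler⟩ := leray_threshold
  set c : ℝ := 4 * Real.pi ^ 2 * ν with hc
  have hcpos : 0 < c := by positivity
  set a : EuclideanSpace ℝ (Fin 3) → Fin 3 → ℂ := fourierData hu hd with ha
  set E₀ : ℝ := ∫ ξ, ∑ l, ‖a ξ l‖ ^ 2 with hE₀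
  have hE₀0 : 0 ≤ E₀ := integral_nonneg fun ξ => Finset.sum_nonneg fun l _ => sq_nonneg _
  set ω : ℝ := θ * c ^ 4 / (E₀ + 1) with hω
  have hωpos : 0 < ω := by positivity
  have hE₀ω : E₀ * ω ≤ θ * c ^ 4 := by
    rw [hω, mul_div_assoc']
    rw [div_le_iff₀ (by positivity)]
    nlinarith [mul_pos hθ (pow_pos hcpos 4)]
  obtain ⟨Cfar, hfar⟩ := stub_farFromLeray ν hν u₀ hu hd hdiv ω hωpos
  obtain ⟨A₂, hA₂⟩ := hasDecay_fourierData hu hd (2 + 0)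
  refine ⟨max Cfar A₂ + 36 * Real.pi / c * (1 * ω + 1⁻¹ * E₀), ?_⟩
  intro T hT V hV hV0 t ht ξ
  have hslack : 0 ≤ 36 * Real.pi / c * (1 * ω + 1⁻¹ * E₀) := by positivity
  -- the data envelope
  have hdat : ∀ ζ : EuclideanSpace ℝ (Fin 3), ‖ζ‖ ^ 2 * ‖V 0 ζ‖ ≤ A₂ := fun ζ => by
    rw [hV0]; simpa using hA₂.pow_mul_norm_le (n := 2) (K := 0) ζ
  set Ens : ℝ → ℝ := fun r => ∫ ξ, ‖ξ‖ ^ 2 * ∑ l, ‖V r ξ l‖ ^ 2 with hEns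
  have hEnsc : Continuous Ens := Leray.continuous_enstrophy hV
  -- energy along `V` (componentwise and in the sup norm)
  have hEle : ∀ r ∈ Icc 0 T, ∫ η, ∑ l, ‖V r η l‖ ^ 2 ≤ E₀ := fun r hr => by
    have := Registered.energyIneq _ _ _ _ V hV r hr
    rw [hV0] at this; exact this
  have hEsup : ∀ r ∈ Icc 0 T, ∫ η, ‖V r η‖ ^ 2 ≤ E₀ := fun r hr => by
    refine le_trans ?_ (hEle r hr)
    exact integral_mono_of_nonneg (Eventually.of_forall fun η => sq_nonneg _) (integrable_sumSq hV r)
      (Eventually.of_forall fun η => norm_sq_le_sum_norm_sq (V r η))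
  have hEnssup : ∀ r, ∫ η, ‖η‖ ^ 2 * ‖V r η‖ ^ 2 ≤ Ens r := fun r =>
    integral_mono_of_nonneg (Eventually.of_forall fun η => by positivity) (integrable_pow_mul_sumSq hV 2 r)
      (Eventually.of_forall fun η => mul_le_mul_of_nonneg_left (norm_sq_le_sum_norm_sq (V r η)) (sq_nonneg _))
  -- the envelope from a time `r₀ ≤ t` with bounded envelope and `Ens r₀ ≤ ω`
  have from_r₀ : ∀ r₀ ∈ Icc 0 t, (∀ ζ : EuclideanSpace ℝ (Fin 3), ‖ζ‖ ^ 2 * ‖V r₀ ζ‖ ≤ max Cfar A₂) →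
      Ens r₀ ≤ ω → ‖ξ‖ ^ 2 * ‖V t ξ‖ ≤ max Cfar A₂ + 36 * Real.pi / c * (1 * ω + 1⁻¹ * E₀) := by
    intro r₀ hr₀ henv hEnsr₀
    have hr₀T : r₀ ≤ T := hr₀.2.trans ht.2
    -- Leray from `r₀`
    have hsmall : (∫ ξ, ∑ l, ‖V r₀ ξ l‖ ^ 2) * (∫ ξ, ‖ξ‖ ^ 2 * ∑ l, ‖V r₀ ξ l‖ ^ 2) ≤ θ * c ^ 4 := by
      calc (∫ ξ, ∑ l, ‖V r₀ ξ l‖ ^ 2) * (∫ ξ, ‖ξ‖ ^ 2 * ∑ l, ‖V r₀ ξ l‖ ^ 2) ≤ E₀ * ω :=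
            mul_le_mul (hEle r₀ ⟨hr₀.1, hr₀T⟩) hEnsr₀
              (integral_nonneg fun ξ => by positivity) hE₀0
        _ ≤ θ * c ^ 4 := hE₀ω
    have hEnsle : ∀ r ∈ Icc r₀ T, Ens r ≤ ω := fun r hr =>
      (hler c 4 0 T V hV r₀ ⟨hr₀.1, hr₀T⟩ hsmall r hr).trans hEnsr₀
    -- the translated solution from `r₀`
    have hW : IsFourierMild c 4 0 (T - r₀) (fun τ => V (τ + r₀)) :=
      Registered.rebase (hV.mono hr₀.1 hr₀T le_rfl)
    have hEW : ∀ τ ∈ Icc 0 (T - r₀), ∫ η, ‖(fun τ => V (τ + r₀)) τ η‖ ^ 2 ≤ E₀ := fun τ hτ =>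
      hEsup (τ + r₀) ⟨by linarith [hτ.1, hr₀.1], by linarith [hτ.2]⟩
    have hΩW : ∀ τ ∈ Icc 0 (T - r₀), ∫ η, ‖η‖ ^ 2 * ‖(fun τ => V (τ + r₀)) τ η‖ ^ 2 ≤ ω := fun τ hτ =>
      (hEnssup (τ + r₀)).trans (hEnsle (τ + r₀) ⟨by linarith [hτ.1], by linarith [hτ.2]⟩)
    have key := Registered.envelope_le_of_enstrophy hW one_pos hEW hΩW (t := t - r₀)
      ⟨by linarith [hr₀.2], by linarith [ht.2]⟩ ξ
    simp only [sub_add_cancel, zero_add] at key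
    linarith [henv ξ]
  by_cases hfarcase : ∀ r ∈ Icc 0 t, ω ≤ Ens r
  · -- far from Leray on all of `[0,t]`: the far stub
    have hhor : t ≤ (∫ ξ, ∑ l, ‖fourierData hu hd ξ l‖ ^ 2) / (2 * (4 * Real.pi ^ 2 * ν) * ω) := by
      have := far_horizon hV hωpos ht hfarcase
      rw [hV0] at this; exact this
    have := hfar T V hV hV0 t ht hhor hfarcase ξ
    linarith [le_max_left Cfar A₂]
  · -- the first time `r₀ ≤ t` at which `Ens ≤ ω`
    push Not at hfarcase
    obtain ⟨r₁, hr₁, hr₁ω⟩ := hfarcase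
    set S : Set ℝ := {r | r ∈ Icc 0 t ∧ Ens r ≤ ω} with hSdef
    have hSne : S.Nonempty := ⟨r₁, hr₁, hr₁ω.le⟩
    have hSbdd : BddBelow S := ⟨0, fun r hr => hr.1.1⟩
    have hSclosed : IsClosed S := isClosed_Icc.inter (isClosed_le hEnsc continuous_const)
    set r₀ : ℝ := sInf S with hr₀def
    have hr₀S : r₀ ∈ S := hSclosed.csInf_mem hSne hSbdd
    have hr₀ : r₀ ∈ Icc 0 t := hr₀S.1
    have hEnsr₀ : Ens r₀ ≤ ω := hr₀S.2
    have hbefore : ∀ r ∈ Ico 0 r₀, ω ≤ Ens r := by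
      intro r hr
      by_contra hlt
      push Not at hlt
      have hrS : r ∈ S := ⟨⟨hr.1, hr.2.le.trans hr₀.2⟩, hlt.le⟩
      exact absurd (csInf_le hSbdd hrS) (not_le.2 hr.2)
    -- the envelope at `r₀`
    have henv : ∀ ζ : EuclideanSpace ℝ (Fin 3), ‖ζ‖ ^ 2 * ‖V r₀ ζ‖ ≤ max Cfar A₂ := by
      intro ζ
      rcases eq_or_lt_of_le hr₀.1 with h0 | h0
      · rw [← h0]; exact (hdat ζ).trans (le_max_right _ _)
      · -- `Ens ≥ ω` on `[0, r₀)` hence on `[0, r₀]` by continuity: the far stub applies at `r₀`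
        have hall : ∀ r ∈ Icc 0 r₀, ω ≤ Ens r := by
          have hclosed : IsClosed {r | ω ≤ Ens r} := isClosed_le continuous_const hEnsc
          have hsub : Ico 0 r₀ ⊆ {r | ω ≤ Ens r} := fun r hr => hbefore r hr
          have := (closure_minimal hsub hclosed)
          rw [closure_Ico h0.ne] at this
          exact fun r hr => this hr
        have hr₀T : r₀ ∈ Icc 0 T := ⟨hr₀.1, hr₀.2.trans ht.2⟩
        have hhor : r₀ ≤ (∫ ξ, ∑ l, ‖fourierData hu hd ξ l‖ ^ 2) / (2 * (4 * Real.pi ^ 2 * ν) * ω) := by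
          have := far_horizon hV hωpos hr₀T hall
          rw [hV0] at this; exact this
        exact (hfar T V hV hV0 r₀ hr₀T hhor hall ζ).trans (le_max_left _ _)
    exact from_r₀ r₀ hr₀ henv hEnsr₀

end Summit.NavierStokesRegularity.NavierStokesRegularity.Cruxes.EnvelopeBound.Birth
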